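import Literature.AlgebraicTopology.SingularHomology.TorusCohomology
import Literature.AlgebraicTopology.SingularHomology.CohomologyRingChange
import HarnessLib

/-!
# Change of coefficient ring for the torus classes: `f_* θ_R = θ_S`, `f_* ξᵢ = ξᵢ`,
# `f_*(ξ_{e 0} ⌣ ⋯) = ξ_{e 0} ⌣ ⋯`

A. Hatcher, *Algebraic Topology* (2002), §3.1 p. 198 (a homomorphism of coefficients induces a
cochain map) and §3.2 p. 215 (the cup product is natural in the coefficient ring). The generator
`θ = circleClass R ∈ H¹(ℝ/ℤ; R)` of `CircleIntegralCocycle.lean` is, for EVERY commutative ring `R`,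
the class of the SAME integer-valued cochain `windingCochain`; hence it is preserved by every change
of coefficient ring `f : R →+* S` (the tree's `singularCohomology.ringChange f`,
`CohomologyRingChange.lean`), and so are the coordinate classes `ξᵢ = pᵢ*θ` and the cup monomials
of the torus (`TorusCohomology.lean`):

* (private copies of `CharacteristicClasses.ringChange_map`, `…ringChange_one`: `f_*` commutes with
  pull-backs, `f_* 1 = 1`);
* `ringChange_cupMonomial` — `f_*` of a cup monomial is the cup monomial of the `f_*` of the factors
  (`ringChange_cupProduct`);
* `ringChange_circleClass` — `f_* θ_R = θ_S`;
* `ringChange_torusXi`, `ringChange_torusMonomial`, `ringChange_torusTop`.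

Used with `f = (ℚ ↪ ℂ)` in `Literature/AlgebraicGeometry/HodgeTheory/TorusRationalClasses.lean` (the
rational classes of `Hᵏ(Tⁿ; ℂ)` are exactly the rational combinations of the cup monomials).
Everything is proved; no named facts.

## References

* A. Hatcher, *Algebraic Topology*, CUP 2002, §3.1 p. 198, §3.2 p. 215, Example 3.16. [HatcherAT2002]
-/

noncomputable section

open CategoryTheory

universe u v

namespace Literature.AlgebraicTopology.SingularHomology

open singularCochainComplex

variable {R S : Type v} [CommRing R] [CommRing S] (f : R →+* S)
variable {X Y : Type u} [TopologicalSpace X] [TopologicalSpace Y] {n : ℕ}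

/-- **Change of coefficients commutes with pull-backs**: `f_*(g^* x) = g^*(f_* x)` (both are
`u ↦ f ∘ u ∘ g_♯` on cochains; Hatcher 2002, §3.1 p. 198). A local copy of
`Literature.AlgebraicTopology.CharacteristicClasses.ringChange_map` (`TopologicalChernClasses.lean`),
not imported to keep the import cone of the torus files free of vector bundles.
[cite: HatcherAT2002, §3.1 p. 198] -/
private theorem ringChange_map' (g : C(X, Y)) (k : ℕ) (x : singularCohomology R R Y k) :
    singularCohomology.ringChange f X k (singularCohomology.map R R g k x) =
      singularCohomology.map S S g k (singularCohomology.ringChange f Y k x) := by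
  induction x using singularCohomology_induction_on with
  | h u =>
    rw [singularCohomology.map_π, singularCohomology.ringChange_π, singularCohomology.ringChange_π,
      singularCohomology.map_π]
    congr 1
    refine coFn_injective ?_
    rw [coFn_cocyclesRingChange, coFn_cocyclesMap, coFn_cocyclesMap, coFn_cocyclesRingChange]
    funext c
    rfl

/-- **`f_* 1 = 1`** (local copy of `Literature.AlgebraicTopology.CharacteristicClasses.ringChange_one`).
[cite: HatcherAT2002, §3.2 p. 215] -/
private theorem ringChange_one' :
    singularCohomology.ringChange f X 0 (singularCohomology.one R X) = singularCohomology.one S X := by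
  rw [singularCohomology.one, singularCohomology.one, singularCohomology.ringChange_π]
  congr 1
  refine coFn_injective ?_
  rw [coFn_cocyclesRingChange, coFn_cocyclesMk, coFn_cocyclesMk]
  funext c
  exact f.map_one

/-- **`f_*` of a cup monomial** is the cup monomial of the `f_*` of the factors (the cup product
is natural in the coefficient ring, Hatcher 2002, §3.2 p. 215). [cite: HatcherAT2002, §3.2 p. 215] -/
theorem ringChange_cupMonomial (x : Fin n → singularCohomology R R Y 1) (k : ℕ) (e : Fin k → Fin n) :
    singularCohomology.ringChange f Y k (cupMonomial x k e) =
      cupMonomial (fun i => singularCohomology.ringChange f Y 1 (x i)) k e := by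
  induction k with
  | zero => exact ringChange_one' f
  | succ k ih => rw [cupMonomial_succ, cupMonomial_succ, singularCohomology.ringChange_cupProduct, ih]

/-- **`f_* θ_R = θ_S`**: the generator of `H¹(ℝ/ℤ)` is the class of one integer-valued cochain for
all coefficient rings. [cite: HatcherAT2002, §3.1 p. 198] -/
theorem ringChange_circleClass :
    singularCohomology.ringChange f UnitAddCircle 1 (circleClass R) = circleClass S := by
  rw [circleClass, circleClass, singularCohomology.ringChange_π]
  congr 1
  refine coFn_injective ?_
  rw [coFn_cocyclesRingChange]
  change f ∘ (iCocycles R R UnitAddCircle 1 (circleCocycle R)) = iCocycles S S UnitAddCircle 1 (circleCocycle S)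
  rw [iCocycles_circleCocycle, iCocycles_circleCocycle]
  funext c
  rw [Function.comp_apply, circleCochain_apply, circleCochain_apply, map_intCast]

/-- **`f_* ξᵢ = ξᵢ`** for the coordinate classes of the torus. [cite: HatcherAT2002, §3.2 Example 3.16] -/
theorem ringChange_torusXi (n : ℕ) (i : Fin n) :
    singularCohomology.ringChange f (Torus n) 1 (torusXi R n i) = torusXi S n i := by
  rw [torusXi, torusXi, ringChange_map', ringChange_circleClass]

/-- **`f_*` preserves the cup monomials of the torus.** [cite: HatcherAT2002, §3.2 Example 3.16] -/
theorem ringChange_torusMonomial (n k : ℕ) (e : Fin k → Fin n) :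
    singularCohomology.ringChange f (Torus n) k (torusMonomial R n k e) = torusMonomial S n k e := by
  rw [torusMonomial, torusMonomial, ringChange_cupMonomial]
  simp only [ringChange_torusXi]

/-- `f_*` preserves the top monomial. [cite: HatcherAT2002, §3.2 Example 3.16] -/
theorem ringChange_torusTop (k : ℕ) :
    singularCohomology.ringChange f (Torus k) k (torusTop R k) = torusTop S k :=
  ringChange_torusMonomial f k k id

end Literature.AlgebraicTopology.SingularHomology
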